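import Mathlib
import Summits.NavierStokesRegularity.NavierStokesRegularity.Theses.FilamentSkeletonRss
import Summits.NavierStokesRegularity.NavierStokesRegularity.Theorems.FilamentSkeletonRssClause13RRateColumnBall
import Summits.NavierStokesRegularity.NavierStokesRegularity.Theorems.FilamentSkeletonRssClause13RTransversality

/-!
# Clause 13-R from a LEAKY rate row `R″(ε)` and the registered clamped 13-J estimate — the composable re-split of crux
# `Clause13RNearStraightL` (stmt-NavierStokesRegularity-23612), with the absorption step typed

Route `FilamentSkeletonRss`, Variant A1R.  The registered line `rate_bordered_split` (098fbcf79f64745c) composes the crux from STUB R (rate row,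
NO `Y`-term in the conclusion) and STUB J (clamped weighted 13-J with the bordered envelope).  By `…Clause13RHomogeneity` /
`…Clause13RTransversality` (p823524, p823674) STUB R is EXACT transversality with zero `Y`-information, which no window pairing with a
non-zero residual can deliver (memo `STRUCTURE-23612-homogeneity-leafhand8-g0.md`, evidence #25 on 23612).  This file types the REPAIR proposed
there (§2): replace STUB R by the LEAKY RATE ROW

  `R″(ε)` — the text of STUB R verbatim (same skeleton class, same admissible test class, envelope kept) with prefix `∀ b, ∀ ε > 0, ∃ (cnd Γ₀)` and tail
  `∀ dα L S, (∀ j τ, ‖Y_j τ‖ ≤ S(1+|τ−c_j|)^b) → (flat bordered in-ball defect ≤ L) → |dα|√Γ ≤ cnd·L + ε·S`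

(STUB R is `R″` with the leak coefficient `ε` replaced by `0`; the «honest reachable form» of hand fsrs-3-g0 is `R″` with `ε ≍ log Γ`), keep STUB J
VERBATIM, and compose with ONE absorption step:

* `clause13RNearStraightL_of_leakyRateRow_of_clamped13J` — **`R″ → Clamped13JBordered → Clause13RNearStraightL` (the crux BY NAME)**.  Constants:
  `Rb₀ := min`, J first (`b, c_J, Γ_J`), `ε := 1/(2c_J(R_w+1)+1)` (so `ε·c_J(R_w+1) ≤ ½`), then `R″` at `(b, ε)` (`c_R, Γ_R`); `a := 0`,
  `c₁ := 2(c_R + εc_J)`, `cnd := max c₁ (c_J(1 + c₁(R_w+1)))`, `Γ₀ := max Γ_J (max Γ_R (max 1 (exp ((R_w/R_b)²))))` (the last entry puts the waist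
  in the ball, `…Clause13RTransversality.waist_radius_le_ball`, whence `0 ≤ L`).  Mechanism: with `A := |dα|√Γ`, the bordered flat defect gives the
  unbordered bound `‖DT·Y‖ ≤ L + |dα|(R_w√Γ + |τ−c_j|) ≤ (L + A(R_w+1))(1 + |τ−c_j|/√Γ)` (unit speed, waist clause 9, `‖R_j‖ ≤ ‖X_j‖`), J gives
  `‖Y_j τ‖ ≤ c_J(L + A(R_w+1))(1+|τ−c_j|)^b`, `R″` with `S := c_J(L + A(R_w+1))` gives `A ≤ c_R L + εc_J(L + A(R_w+1))`, absorption gives `A ≤ c₁L`,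
  and J's bound becomes `‖Y_j τ‖ ≤ c_J(1 + c₁(R_w+1))·L·(1+|τ−c_j|)^b`.
* `leakyRateRow_of_rateRow13RFlat` — STUB R (verbatim) ⟹ `R″` (`0 ≤ S` from the size hypothesis at a waist), so the re-split is a WEAKENING of
  the R-side: every proof of the registered line also closes the re-split line.  (The envelope hypothesis kept in `R″` is idle by the same
  homogeneity as in `…Clause13RHomogeneity` — `R″` is degree-one homogeneous in `(Y, dα, L, S)`.)

A line-writer can register `Lines/leaky_rate_bordered_split.lean` with stubs `stub_leakyRateRow13R : R″` (size L: window pairing with an improved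
annihilator; OPEN) and `stub_clamped13JBordered` (as registered, XL) and this file's composition as the closing theorem.  Texts verbatim / def-free.
Hand `leafhand-ns-filamentskeletonrs-8-g0` (LAND-ONLY); `--supports stmt-NavierStokesRegularity-23612` helper.  HONEST FRAMING: glue between CANDIDATE
statements about a HYPOTHETICAL near-straight filament skeleton on the NEGATIVE side of a MODEL blow-up route; neither `R″` nor J nor the crux is
proved here, and nothing in this file bears on Navier–Stokes regularity or blow-up.
-/

noncomputable section

open Real Filter MeasureTheory Literature.Analysis.FluidPDE
open scoped RealInnerProductSpace InnerProductSpace Topology BigOperators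
open Summit.NavierStokesRegularity.NavierStokesRegularity.Theorems.MatchedKernel (norm_sub_inner_smul_le norm_cross_single_two_le)
open Summit.NavierStokesRegularity.NavierStokesRegularity.Theorems.Clause13RRateRow (norm_le_waist_add)
open Summit.NavierStokesRegularity.NavierStokesRegularity.Theorems.Clause13RTransversality (waist_radius_le_ball)

namespace Summit.NavierStokesRegularity.NavierStokesRegularity.Theorems.Clause13RLeakySplit
set_option linter.dupNamespace false

/-- The arithmetic of the unbordered envelope: `L + a(R_w s + t) ≤ (L + a s (R_w+1))(1 + t/s)` for `L, a, t, R_w ≥ 0 < s`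
(`a = |dα|`, `s = √Γ`, `t = |τ − c_j|`). [folklore] -/
theorem unbordered_envelope_arith {L a s t Rw : ℝ} (hL : 0 ≤ L) (ha : 0 ≤ a) (hs : 0 < s) (ht : 0 ≤ t) (hRw : 0 ≤ Rw) :
    L + a * (Rw * s + t) ≤ (L + a * s * (Rw + 1)) * (1 + t / s) := by
  have h1 : (L + a * s * (Rw + 1)) * (1 + t / s) = L + a * s * Rw + a * s + L * (t / s) + a * (Rw + 1) * t := by
    field_simp
    ring
  rw [h1]
  nlinarith [mul_nonneg hL (div_nonneg ht hs.le), mul_nonneg ha hs.le, mul_nonneg (mul_nonneg ha hRw) ht]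

/-- **THE COMPOSITION.**  The leaky rate row `R″` and the registered clamped 13-J estimate (STUB J, verbatim) imply the crux
`FilamentSkeletonRss.Clause13RNearStraightL` BY NAME, with one absorption step (constants in the module docstring). -/
theorem clause13RNearStraightL_of_leakyRateRow_of_clamped13J
    (hR : (open Literature.Analysis.FluidPDE in ∀ (N : ℕ) (δ ρ K Λ Rw cg θ₀ KA : ℝ), 0 < N → 0 < δ → 0 < ρ → 0 < Rw → 0 < cg → 0 < θ₀ → ∃ Rb₀ : ℝ, 0 < Rb₀ ∧ ∀ Rb : ℝ, 0 < Rb → Rb ≤ Rb₀ → ∀ b : ℝ, ∀ ε : ℝ, 0 < ε → ∃ (cnd Γ₀ : ℝ), 0 < cnd ∧ ∀ Γ : ℝ, Γ₀ ≤ Γ → ∀ (γ : Fin N → ℝ) (α : ℝ) (X : Fin N → ℝ → EuclideanSpace ℝ (Fin 3)) (w : Fin N → ℝ → ℝ) (c : Fin N → ℝ) (Aa : Fin N → ℝ → ℝ), (∀ (u:(Fin N → ℝ → EuclideanSpace ℝ (Fin 3)) → EuclideanSpace ℝ (Fin 3) → EuclideanSpace ℝ (Fin 3)) (v:EuclideanSpace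 ℝ (Fin 3) → EuclideanSpace ℝ (Fin 3)) (A:Fin N → (EuclideanSpace ℝ (Fin 3) →L[ℝ] EuclideanSpace ℝ (Fin 3))) (T:(Fin N → ℝ → EuclideanSpace ℝ (Fin 3)) → Fin N → ℝ → EuclideanSpace ℝ (Fin 3)), (∀ Z y, u Z y = ∑ k, (Γ*γ k/(4*Real.pi))•∫ σ:ℝ, ((‖y-Z k σ‖^2+Real.exp (-(1+Real.eulerMascheroniConstant-Real.log 2))*Aa k σ)^(3/2:ℝ))⁻¹•cross (deriv (Z k) σ) (y-Z k σ))→(∀ y, v y = u X y+(1/2:ℝ)•y-α•cross (EuclideanSpace.single 2 1) y)→(∀ j, A j = fderiv ℝ v (X j (c j)))→(∀ Z j τ, T Z j τ = (u Z (Z j τ)+(1/2:ℝ)•Z j τ-α•cross (EuclideanSpace.single 2 1) (Z j τ))-(⟪u Z (Z j τ)+(1/2:ℝ)•Z j τ-α•cross (EuclideanSpace.single 2 1) (Z j τ), deriv (Z j) τ⟫_ℝ/‖deriv (Z j) τ‖^2)•deriv (Z j) τ)→(α ≠ 0 ∧ (∀ j, γ j ≠ 0) ∧ (∀ j, ContDiff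 ℝ 2 (X j) ∧ Differentiable ℝ (w j)∧(∀ τ, ‖deriv (X j) τ‖ = 1)∧(∀ τ, ‖iteratedDeriv 2 (X j) τ‖*√Γ≤K) ∧ Tendsto (fun τ => ‖X j τ‖) (cocompact ℝ) atTop) ∧ (∀ j k, j ≠ k → ∀ τ σ, ρ*√Γ≤‖X j τ-X k σ‖) ∧ (∀ j τ σ, ρ*√Γ≤|τ-σ| → cg*ρ*√Γ≤‖X j τ-X j σ‖) ∧ (∀ j τ, cg*|τ-c j|≤Rw*√Γ+‖X j τ‖) ∧ (∀ j τ, w j τ = ⟪v (X j τ), deriv (X j) τ⟫_ℝ) ∧ (∀ j τ, ‖X j τ‖≤Rb*√(Γ*Real.log Γ) → v (X j τ) = w j τ•deriv (X j) τ) ∧ (∀ j, ‖X j (c j)‖≤Rw*√Γ) ∧ (∀ j, |⟪deriv (X j) (c j), EuclideanSpace.single 2 1⟫_ℝ|≤1-θ₀) ∧ (θ₀≤|α| ∧ |α|≤θ₀⁻¹ ∧ ∀ j, θ₀≤|γ j| ∧ |γ j|≤θ₀⁻¹) ∧ (∀ j, w j (c j) = 0 ∧ (∀ τ, w j τ = 0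 → τ = c j) ∧ 3/2+δ≤deriv (w j) (c j) ∧ deriv (w j) (c j)≤Λ) ∧ (∀ j, Differentiable ℝ (Aa j) ∧ (∀ τ, 0 < Aa j τ) ∧ 1≤KA*Aa j (c j) ∧ ∀ τ, ‖X j τ‖≤2*Rb*√(Γ*Real.log Γ) → Aa j τ = Aa j (c j)) ∧ (∀ j τ, Rw^2*Γ*Aa j τ≤KA*(Rw^2*Γ+‖X j τ‖^2)))) → ((∀ j τ σ, ‖deriv (X j) τ - deriv (X j) σ‖ ≤ Rb) ∧ (∀ j τ, |deriv (w j) τ| ≤ Λ) ∧ (∀ j τ, Λ⁻¹ ≤ Aa j τ)) → (∀ (u:(Fin N → ℝ → EuclideanSpace ℝ (Fin 3)) → EuclideanSpace ℝ (Fin 3) → EuclideanSpace ℝ (Fin 3)) (v:EuclideanSpace ℝ (Fin 3) → EuclideanSpace ℝ (Fin 3)) (A:Fin N → (EuclideanSpace ℝ (Fin 3) →L[ℝ] EuclideanSpace ℝ (Fin 3))) (T:(Fin N → ℝ → EuclideanSpace ℝ (Fin 3)) → Fin N → ℝ → EuclideanSpace ℝ (Fin 3)), (∀ Z y, u Z y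 = ∑ k, (Γ*γ k/(4*Real.pi))•∫ σ:ℝ, ((‖y-Z k σ‖^2+Real.exp (-(1+Real.eulerMascheroniConstant-Real.log 2))*Aa k σ)^(3/2:ℝ))⁻¹•cross (deriv (Z k) σ) (y-Z k σ))→(∀ y, v y = u X y+(1/2:ℝ)•y-α•cross (EuclideanSpace.single 2 1) y)→(∀ j, A j = fderiv ℝ v (X j (c j)))→(∀ Z j τ, T Z j τ = (u Z (Z j τ)+(1/2:ℝ)•Z j τ-α•cross (EuclideanSpace.single 2 1) (Z j τ))-(⟪u Z (Z j τ)+(1/2:ℝ)•Z j τ-α•cross (EuclideanSpace.single 2 1) (Z j τ), deriv (Z j) τ⟫_ℝ/‖deriv (Z j) τ‖^2)•deriv (Z j) τ)→(∀ Y:Fin N → ℝ → EuclideanSpace ℝ (Fin 3), (∀ j, ContDiff ℝ 2 (Y j))→(∀ j τ, ⟪Y j τ, deriv (X j) τ⟫_ℝ = 0) → (∀ j τ, Rb*√(Γ*Real.log Γ) < ‖X j τ‖ → Y j τ = 0) → ∑ j, ⟪Y j (c j), cross (EuclideanSpace.single 2 1) (X j (c j))⟫_ℝ = 0 → (∀ j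 τ, ‖Y j τ‖+‖deriv (Y j) τ‖+‖iteratedDeriv 2 (Y j) τ‖≤(1+|τ-c j|)^b) → ∀ dα L S:ℝ, (∀ j τ, ‖Y j τ‖≤S*(1+|τ-c j|)^b) → (∀ j τ, ‖X j τ‖≤Rb*√(Γ*Real.log Γ) → ‖deriv (fun s:ℝ => T (fun k σ => X k σ+s•Y k σ) j τ) 0-dα•(cross (EuclideanSpace.single 2 1) (X j τ)-⟪cross (EuclideanSpace.single 2 1) (X j τ), deriv (X j) τ⟫_ℝ•deriv (X j) τ)‖≤L) → |dα| * √Γ≤cnd*L+ε*S))))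
    (hJ : (open Literature.Analysis.FluidPDE in ∀ (N : ℕ) (δ ρ K Λ Rw cg θ₀ KA : ℝ), 0 < N → 0 < δ → 0 < ρ → 0 < Rw → 0 < cg → 0 < θ₀ → ∃ Rb₀ : ℝ, 0 < Rb₀ ∧ ∀ Rb : ℝ, 0 < Rb → Rb ≤ Rb₀ → ∃ (b cnd Γ₀ : ℝ), 0 < cnd ∧ ∀ Γ : ℝ, Γ₀ ≤ Γ → ∀ (γ : Fin N → ℝ) (α : ℝ) (X : Fin N → ℝ → EuclideanSpace ℝ (Fin 3)) (w : Fin N → ℝ → ℝ) (c : Fin N → ℝ) (Aa : Fin N → ℝ → ℝ), (∀ (u:(Fin N → ℝ → EuclideanSpace ℝ (Fin 3)) → EuclideanSpace ℝ (Fin 3) → EuclideanSpace ℝ (Fin 3)) (v:EuclideanSpace ℝ (Fin 3) → EuclideanSpace ℝ (Fin 3)) (A:Fin N → (EuclideanSpace ℝ (Fin 3) →L[ℝ] EuclideanSpace ℝ (Fin 3))) (T:(Fin N → ℝ → EuclideanSpace ℝ (Fin 3)) → Fin N → ℝ → EuclideanSpace ℝ (Fin 3)), (∀ Z y, u Z y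 = ∑ k, (Γ*γ k/(4*Real.pi))•∫ σ:ℝ, ((‖y-Z k σ‖^2+Real.exp (-(1+Real.eulerMascheroniConstant-Real.log 2))*Aa k σ)^(3/2:ℝ))⁻¹•cross (deriv (Z k) σ) (y-Z k σ))→(∀ y, v y = u X y+(1/2:ℝ)•y-α•cross (EuclideanSpace.single 2 1) y)→(∀ j, A j = fderiv ℝ v (X j (c j)))→(∀ Z j τ, T Z j τ = (u Z (Z j τ)+(1/2:ℝ)•Z j τ-α•cross (EuclideanSpace.single 2 1) (Z j τ))-(⟪u Z (Z j τ)+(1/2:ℝ)•Z j τ-α•cross (EuclideanSpace.single 2 1) (Z j τ), deriv (Z j) τ⟫_ℝ/‖deriv (Z j) τ‖^2)•deriv (Z j) τ)→(α ≠ 0 ∧ (∀ j, γ j ≠ 0) ∧ (∀ j, ContDiff ℝ 2 (X j) ∧ Differentiable ℝ (w j)∧(∀ τ, ‖deriv (X j) τ‖ = 1)∧(∀ τ, ‖iteratedDeriv 2 (X j) τ‖*√Γ≤K) ∧ Tendsto (fun τ => ‖X j τ‖) (cocompact ℝ) atTop) ∧ (∀ j k, j ≠ k → ∀ τ σ, ρ*√Γ≤‖X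 j τ-X k σ‖) ∧ (∀ j τ σ, ρ*√Γ≤|τ-σ| → cg*ρ*√Γ≤‖X j τ-X j σ‖) ∧ (∀ j τ, cg*|τ-c j|≤Rw*√Γ+‖X j τ‖) ∧ (∀ j τ, w j τ = ⟪v (X j τ), deriv (X j) τ⟫_ℝ) ∧ (∀ j τ, ‖X j τ‖≤Rb*√(Γ*Real.log Γ) → v (X j τ) = w j τ•deriv (X j) τ) ∧ (∀ j, ‖X j (c j)‖≤Rw*√Γ) ∧ (∀ j, |⟪deriv (X j) (c j), EuclideanSpace.single 2 1⟫_ℝ|≤1-θ₀) ∧ (θ₀≤|α| ∧ |α|≤θ₀⁻¹ ∧ ∀ j, θ₀≤|γ j| ∧ |γ j|≤θ₀⁻¹) ∧ (∀ j, w j (c j) = 0 ∧ (∀ τ, w j τ = 0 → τ = c j) ∧ 3/2+δ≤deriv (w j) (c j) ∧ deriv (w j) (c j)≤Λ) ∧ (∀ j, Differentiable ℝ (Aa j) ∧ (∀ τ, 0 < Aa j τ) ∧ 1≤KA*Aa j (c j) ∧ ∀ τ, ‖X j τ‖≤2*Rb*√(Γ*Real.log Γ) → Aa j τ = Aa j (c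 j)) ∧ (∀ j τ, Rw^2*Γ*Aa j τ≤KA*(Rw^2*Γ+‖X j τ‖^2)))) → ((∀ j τ σ, ‖deriv (X j) τ - deriv (X j) σ‖ ≤ Rb) ∧ (∀ j τ, |deriv (w j) τ| ≤ Λ) ∧ (∀ j τ, Λ⁻¹ ≤ Aa j τ)) → (∀ (u:(Fin N → ℝ → EuclideanSpace ℝ (Fin 3)) → EuclideanSpace ℝ (Fin 3) → EuclideanSpace ℝ (Fin 3)) (v:EuclideanSpace ℝ (Fin 3) → EuclideanSpace ℝ (Fin 3)) (A:Fin N → (EuclideanSpace ℝ (Fin 3) →L[ℝ] EuclideanSpace ℝ (Fin 3))) (T:(Fin N → ℝ → EuclideanSpace ℝ (Fin 3)) → Fin N → ℝ → EuclideanSpace ℝ (Fin 3)), (∀ Z y, u Z y = ∑ k, (Γ*γ k/(4*Real.pi))•∫ σ:ℝ, ((‖y-Z k σ‖^2+Real.exp (-(1+Real.eulerMascheroniConstant-Real.log 2))*Aa k σ)^(3/2:ℝ))⁻¹•cross (deriv (Z k) σ) (y-Z k σ))→(∀ y, v y = u X y+(1/2:ℝ)•y-α•cross (EuclideanSpace.single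 2 1) y)→(∀ j, A j = fderiv ℝ v (X j (c j)))→(∀ Z j τ, T Z j τ = (u Z (Z j τ)+(1/2:ℝ)•Z j τ-α•cross (EuclideanSpace.single 2 1) (Z j τ))-(⟪u Z (Z j τ)+(1/2:ℝ)•Z j τ-α•cross (EuclideanSpace.single 2 1) (Z j τ), deriv (Z j) τ⟫_ℝ/‖deriv (Z j) τ‖^2)•deriv (Z j) τ)→(∀ Y:Fin N → ℝ → EuclideanSpace ℝ (Fin 3), (∀ j, ContDiff ℝ 2 (Y j))→(∀ j τ, ⟪Y j τ, deriv (X j) τ⟫_ℝ = 0) → (∀ j τ, Rb*√(Γ*Real.log Γ) < ‖X j τ‖ → Y j τ = 0) → ∑ j, ⟪Y j (c j), cross (EuclideanSpace.single 2 1) (X j (c j))⟫_ℝ = 0 → (∀ j τ, ‖Y j τ‖+‖deriv (Y j) τ‖+‖iteratedDeriv 2 (Y j) τ‖≤(1+|τ-c j|)^b) → ∀ L:ℝ, (∀ j τ, ‖X j τ‖≤Rb*√(Γ*Real.log Γ) → ‖deriv (fun s:ℝ => T (fun k σ => X k σ+s•Y k σ) j τ) 0‖≤L*(1+|τ-c j|/√Γ))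 → ∀ j τ, ‖Y j τ‖≤cnd*L*(1+|τ-c j|)^b)))) :
    Summit.NavierStokesRegularity.NavierStokesRegularity.Theses.FilamentSkeletonRss.Clause13RNearStraightL := by
  intro N δ ρ K Λ Rw cg θ₀ KA hN hδ hρ hRw hcg hθ₀
  obtain ⟨RbR, hRbR, hRfam⟩ := hR N δ ρ K Λ Rw cg θ₀ KA hN hδ hρ hRw hcg hθ₀
  obtain ⟨RbJ, hRbJ, hJfam⟩ := hJ N δ ρ K Λ Rw cg θ₀ KA hN hδ hρ hRw hcg hθ₀
  refine ⟨min RbR RbJ, lt_min hRbR hRbJ, fun Rb hRb hRb₀ => ?_⟩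
  obtain ⟨b, cJ, ΓJ, hcJ, hJΓ⟩ := hJfam Rb hRb (le_trans hRb₀ (min_le_right _ _))
  have hden : 0 < 2 * cJ * (Rw + 1) + 1 := by positivity
  set ε : ℝ := 1 / (2 * cJ * (Rw + 1) + 1) with hε
  have hεpos : 0 < ε := by rw [hε]; positivity
  have hεabs : ε * (cJ * (Rw + 1)) ≤ 1 / 2 := by
    rw [hε, div_mul_eq_mul_div, one_mul, div_le_iff₀ hden]
    nlinarith [hcJ, hRw]
  obtain ⟨cR, ΓR, hcR, hRΓ⟩ := hRfam Rb hRb (le_trans hRb₀ (min_le_left _ _)) b ε hεpos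
  set c₁ : ℝ := 2 * (cR + ε * cJ) with hc₁
  have hc₁pos : 0 < c₁ := by rw [hc₁]; positivity
  refine ⟨0, b, max c₁ (cJ * (1 + c₁ * (Rw + 1))), max ΓJ (max ΓR (max 1 (Real.exp ((Rw / Rb) ^ 2)))), le_rfl,
    lt_max_iff.2 (Or.inl hc₁pos), fun Γ hΓ => ?_⟩
  have hΓJ : ΓJ ≤ Γ := le_trans (le_max_left _ _) hΓ
  have hΓR : ΓR ≤ Γ := le_trans (le_trans (le_max_left _ _) (le_max_right _ _)) hΓ
  have hΓ1 : max 1 (Real.exp ((Rw / Rb) ^ 2)) ≤ Γ := le_trans (le_trans (le_max_right _ _) (le_max_right _ _)) hΓ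
  have hΓone : (1:ℝ) ≤ Γ := le_trans (le_max_left _ _) hΓ1
  have hs : (1:ℝ) ≤ √Γ := by simpa using Real.sqrt_le_sqrt hΓone
  have hs0 : 0 < √Γ := lt_of_lt_of_le one_pos hs
  intro γ α X w c Aa hH hNS u v A T hu hv hA hT Y hY2 hYn hYoff hYph hYenv dα L hdef
  obtain ⟨-, -, h3, -, -, -, -, -, h9, -⟩ := hH u v A T hu hv hA hT
  -- the waist of filament `0` lies in the ball, so `0 ≤ L`
  have hL : 0 ≤ L := by
    have hin₀ : ‖X ⟨0, hN⟩ (c ⟨0, hN⟩)‖ ≤ Rb * √(Γ * Real.log Γ) :=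
      le_trans (h9 ⟨0, hN⟩) (waist_radius_le_ball hRw hRb hΓ1)
    have h := hdef ⟨0, hN⟩ (c ⟨0, hN⟩) hin₀
    rw [Real.rpow_zero, mul_one] at h
    exact le_trans (norm_nonneg _) h
  set Aα : ℝ := |dα| * √Γ with hAdef
  have hA0 : 0 ≤ Aα := by rw [hAdef]; positivity
  -- the unbordered in-ball defect bound that STUB J consumes
  have key : ∀ j τ, ‖X j τ‖ ≤ Rb * √(Γ * Real.log Γ) →
      ‖deriv (fun s:ℝ => T (fun k σ => X k σ + s • Y k σ) j τ) 0‖ ≤ (L + Aα * (Rw + 1)) * (1 + |τ - c j| / √Γ) := by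
    intro j τ hin
    have hunit : ∀ σ, ‖deriv (X j) σ‖ = 1 := (h3 j).2.2.1
    have hXd : Differentiable ℝ (X j) := (h3 j).1.differentiable (by norm_num)
    have hXn : ‖X j τ‖ ≤ Rw * √Γ + |τ - c j| :=
      le_trans (norm_le_waist_add hXd hunit (c j) τ) (add_le_add (h9 j) le_rfl)
    set P : EuclideanSpace ℝ (Fin 3) := cross (EuclideanSpace.single 2 1) (X j τ)
      - ⟪cross (EuclideanSpace.single 2 1) (X j τ), deriv (X j) τ⟫_ℝ • deriv (X j) τ with hP
    set D : EuclideanSpace ℝ (Fin 3) := deriv (fun s:ℝ => T (fun k σ => X k σ + s • Y k σ) j τ) 0 with hD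
    have hPn : ‖P‖ ≤ Rw * √Γ + |τ - c j| :=
      le_trans (le_trans (norm_sub_inner_smul_le _ _ (hunit τ)) (norm_cross_single_two_le _)) hXn
    have hbd := hdef j τ hin
    rw [Real.rpow_zero, mul_one] at hbd
    have htri : ‖D‖ ≤ ‖D - dα • P‖ + ‖dα • P‖ := by
      have h := norm_add_le (D - dα • P) (dα • P)
      rwa [sub_add_cancel] at h
    rw [norm_smul, Real.norm_eq_abs] at htri
    have h1 : ‖D‖ ≤ L + |dα| * (Rw * √Γ + |τ - c j|) := by
      nlinarith [htri, hbd, mul_le_mul_of_nonneg_left hPn (abs_nonneg dα)]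
    have h2 := unbordered_envelope_arith hL (abs_nonneg dα) hs0 (abs_nonneg (τ - c j)) hRw.le
    have h3' : L + |dα| * √Γ * (Rw + 1) = L + Aα * (Rw + 1) := by rw [hAdef]
    rw [h3'] at h2
    exact h1.trans h2
  have hYJ := hJΓ Γ hΓJ γ α X w c Aa hH hNS u v A T hu hv hA hT Y hY2 hYn hYoff hYph hYenv (L + Aα * (Rw + 1)) key
  -- the leaky rate row with `S := c_J (L + A(R_w+1))`
  have hrate : |dα| * √Γ ≤ cR * L + ε * (cJ * (L + Aα * (Rw + 1))) :=
    hRΓ Γ hΓR γ α X w c Aa hH hNS u v A T hu hv hA hT Y hY2 hYn hYoff hYph hYenv dα L (cJ * (L + Aα * (Rw + 1)))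
      (fun j τ => by have h := hYJ j τ; linarith [h])
      (fun j τ hin => by simpa using hdef j τ hin)
  -- absorption
  have hrate' : Aα ≤ c₁ * L := by
    have h1 : ε * (cJ * (Rw + 1)) * Aα ≤ 1 / 2 * Aα := mul_le_mul_of_nonneg_right hεabs hA0
    have h2 : Aα ≤ cR * L + ε * (cJ * (L + Aα * (Rw + 1))) := hrate
    rw [hc₁]
    nlinarith [h1, h2]
  refine ⟨fun j τ => ?_, le_trans hrate' (mul_le_mul_of_nonneg_right (le_max_left _ _) hL)⟩
  have hw : 0 ≤ (1 + |τ - c j|) ^ b := Real.rpow_nonneg (by positivity) b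
  have h1 : L + Aα * (Rw + 1) ≤ (1 + c₁ * (Rw + 1)) * L := by
    nlinarith [mul_le_mul_of_nonneg_right hrate' (by positivity : (0:ℝ) ≤ Rw + 1)]
  calc ‖Y j τ‖ ≤ cJ * (L + Aα * (Rw + 1)) * (1 + |τ - c j|) ^ b := hYJ j τ
    _ ≤ cJ * ((1 + c₁ * (Rw + 1)) * L) * (1 + |τ - c j|) ^ b :=
        mul_le_mul_of_nonneg_right (mul_le_mul_of_nonneg_left h1 hcJ.le) hw
    _ = (cJ * (1 + c₁ * (Rw + 1))) * L * (1 + |τ - c j|) ^ b := by ring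
    _ ≤ max c₁ (cJ * (1 + c₁ * (Rw + 1))) * L * (1 + |τ - c j|) ^ b :=
        mul_le_mul_of_nonneg_right (mul_le_mul_of_nonneg_right (le_max_right _ _) hL) hw

/-- STUB R (verbatim) implies the leaky rate row `R″`: the re-split WEAKENS the R-side (the leak allowance `ε·S` is non-negative since
`‖Y_0(c_0)‖ ≤ S·(1+0)^b` forces `0 ≤ S`). -/
theorem leakyRateRow_of_rateRow13RFlat
    (hR : (open Literature.Analysis.FluidPDE in ∀ (N : ℕ) (δ ρ K Λ Rw cg θ₀ KA : ℝ), 0 < N → 0 < δ → 0 < ρ → 0 < Rw → 0 < cg → 0 < θ₀ → ∃ Rb₀ : ℝ, 0 < Rb₀ ∧ ∀ Rb : ℝ, 0 < Rb → Rb ≤ Rb₀ → ∀ b : ℝ, ∃ (cnd Γ₀ : ℝ), 0 < cnd ∧ ∀ Γ : ℝ, Γ₀ ≤ Γ → ∀ (γ : Fin N → ℝ) (α : ℝ) (X : Fin N → ℝ → EuclideanSpace ℝ (Fin 3)) (w : Fin N → ℝ → ℝ) (c : Fin N → ℝ) (Aa : Fin N → ℝ → ℝ), (∀ (u:(Fin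 N → ℝ → EuclideanSpace ℝ (Fin 3)) → EuclideanSpace ℝ (Fin 3) → EuclideanSpace ℝ (Fin 3)) (v:EuclideanSpace ℝ (Fin 3) → EuclideanSpace ℝ (Fin 3)) (A:Fin N → (EuclideanSpace ℝ (Fin 3) →L[ℝ] EuclideanSpace ℝ (Fin 3))) (T:(Fin N → ℝ → EuclideanSpace ℝ (Fin 3)) → Fin N → ℝ → EuclideanSpace ℝ (Fin 3)), (∀ Z y, u Z y = ∑ k, (Γ*γ k/(4*Real.pi))•∫ σ:ℝ, ((‖y-Z k σ‖^2+Real.exp (-(1+Real.eulerMascheroniConstant-Real.log 2))*Aa k σ)^(3/2:ℝ))⁻¹•cross (deriv (Z k) σ) (y-Z k σ))→(∀ y, v y = u X y+(1/2:ℝ)•y-α•cross (EuclideanSpace.single 2 1) y)→(∀ j, A j = fderiv ℝ v (X j (c j)))→(∀ Z j τ, T Z j τ = (u Z (Z j τ)+(1/2:ℝ)•Z j τ-α•cross (EuclideanSpace.single 2 1) (Z j τ))-(⟪u Z (Z j τ)+(1/2:ℝ)•Z j τ-α•cross (EuclideanSpace.single 2 1) (Z j τ), deriv (Z j) τ⟫_ℝ/‖deriv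 (Z j) τ‖^2)•deriv (Z j) τ)→(α ≠ 0 ∧ (∀ j, γ j ≠ 0) ∧ (∀ j, ContDiff ℝ 2 (X j) ∧ Differentiable ℝ (w j)∧(∀ τ, ‖deriv (X j) τ‖ = 1)∧(∀ τ, ‖iteratedDeriv 2 (X j) τ‖*√Γ≤K) ∧ Tendsto (fun τ => ‖X j τ‖) (cocompact ℝ) atTop) ∧ (∀ j k, j ≠ k → ∀ τ σ, ρ*√Γ≤‖X j τ-X k σ‖) ∧ (∀ j τ σ, ρ*√Γ≤|τ-σ| → cg*ρ*√Γ≤‖X j τ-X j σ‖) ∧ (∀ j τ, cg*|τ-c j|≤Rw*√Γ+‖X j τ‖) ∧ (∀ j τ, w j τ = ⟪v (X j τ), deriv (X j) τ⟫_ℝ) ∧ (∀ j τ, ‖X j τ‖≤Rb*√(Γ*Real.log Γ) → v (X j τ) = w j τ•deriv (X j) τ) ∧ (∀ j, ‖X j (c j)‖≤Rw*√Γ) ∧ (∀ j, |⟪deriv (X j) (c j), EuclideanSpace.single 2 1⟫_ℝ|≤1-θ₀) ∧ (θ₀≤|α| ∧ |α|≤θ₀⁻¹ ∧ ∀ j,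 θ₀≤|γ j| ∧ |γ j|≤θ₀⁻¹) ∧ (∀ j, w j (c j) = 0 ∧ (∀ τ, w j τ = 0 → τ = c j) ∧ 3/2+δ≤deriv (w j) (c j) ∧ deriv (w j) (c j)≤Λ) ∧ (∀ j, Differentiable ℝ (Aa j) ∧ (∀ τ, 0 < Aa j τ) ∧ 1≤KA*Aa j (c j) ∧ ∀ τ, ‖X j τ‖≤2*Rb*√(Γ*Real.log Γ) → Aa j τ = Aa j (c j)) ∧ (∀ j τ, Rw^2*Γ*Aa j τ≤KA*(Rw^2*Γ+‖X j τ‖^2)))) → ((∀ j τ σ, ‖deriv (X j) τ - deriv (X j) σ‖ ≤ Rb) ∧ (∀ j τ, |deriv (w j) τ| ≤ Λ) ∧ (∀ j τ, Λ⁻¹ ≤ Aa j τ)) → (∀ (u:(Fin N → ℝ → EuclideanSpace ℝ (Fin 3)) → EuclideanSpace ℝ (Fin 3) → EuclideanSpace ℝ (Fin 3)) (v:EuclideanSpace ℝ (Fin 3) → EuclideanSpace ℝ (Fin 3)) (A:Fin N → (EuclideanSpace ℝ (Fin 3) →L[ℝ] EuclideanSpace ℝ (Fin 3))) (T:(Fin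 N → ℝ → EuclideanSpace ℝ (Fin 3)) → Fin N → ℝ → EuclideanSpace ℝ (Fin 3)), (∀ Z y, u Z y = ∑ k, (Γ*γ k/(4*Real.pi))•∫ σ:ℝ, ((‖y-Z k σ‖^2+Real.exp (-(1+Real.eulerMascheroniConstant-Real.log 2))*Aa k σ)^(3/2:ℝ))⁻¹•cross (deriv (Z k) σ) (y-Z k σ))→(∀ y, v y = u X y+(1/2:ℝ)•y-α•cross (EuclideanSpace.single 2 1) y)→(∀ j, A j = fderiv ℝ v (X j (c j)))→(∀ Z j τ, T Z j τ = (u Z (Z j τ)+(1/2:ℝ)•Z j τ-α•cross (EuclideanSpace.single 2 1) (Z j τ))-(⟪u Z (Z j τ)+(1/2:ℝ)•Z j τ-α•cross (EuclideanSpace.single 2 1) (Z j τ), deriv (Z j) τ⟫_ℝ/‖deriv (Z j) τ‖^2)•deriv (Z j) τ)→(∀ Y:Fin N → ℝ → EuclideanSpace ℝ (Fin 3), (∀ j, ContDiff ℝ 2 (Y j))→(∀ j τ, ⟪Y j τ, deriv (X j) τ⟫_ℝ = 0) → (∀ j τ, Rb*√(Γ*Real.log Γ) < ‖X j τ‖ →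 Y j τ = 0) → ∑ j, ⟪Y j (c j), cross (EuclideanSpace.single 2 1) (X j (c j))⟫_ℝ = 0 → (∀ j τ, ‖Y j τ‖+‖deriv (Y j) τ‖+‖iteratedDeriv 2 (Y j) τ‖≤(1+|τ-c j|)^b) → ∀ dα L:ℝ, (∀ j τ, ‖X j τ‖≤Rb*√(Γ*Real.log Γ) → ‖deriv (fun s:ℝ => T (fun k σ => X k σ+s•Y k σ) j τ) 0-dα•(cross (EuclideanSpace.single 2 1) (X j τ)-⟪cross (EuclideanSpace.single 2 1) (X j τ), deriv (X j) τ⟫_ℝ•deriv (X j) τ)‖≤L) → |dα| * √Γ≤cnd*L)))) :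
    (open Literature.Analysis.FluidPDE in ∀ (N : ℕ) (δ ρ K Λ Rw cg θ₀ KA : ℝ), 0 < N → 0 < δ → 0 < ρ → 0 < Rw → 0 < cg → 0 < θ₀ → ∃ Rb₀ : ℝ, 0 < Rb₀ ∧ ∀ Rb : ℝ, 0 < Rb → Rb ≤ Rb₀ → ∀ b : ℝ, ∀ ε : ℝ, 0 < ε → ∃ (cnd Γ₀ : ℝ), 0 < cnd ∧ ∀ Γ : ℝ, Γ₀ ≤ Γ → ∀ (γ : Fin N → ℝ) (α : ℝ) (X : Fin N → ℝ → EuclideanSpace ℝ (Fin 3)) (w : Fin N → ℝ → ℝ) (c : Fin N → ℝ) (Aa : Fin N → ℝ → ℝ), (∀ (u:(Fin N → ℝ → EuclideanSpace ℝ (Fin 3)) → EuclideanSpace ℝ (Fin 3) → EuclideanSpace ℝ (Fin 3)) (v:EuclideanSpace ℝ (Fin 3) → EuclideanSpace ℝ (Fin 3)) (A:Fin N → (EuclideanSpace ℝ (Fin 3) →L[ℝ] EuclideanSpace ℝ (Fin 3))) (T:(Fin N → ℝ → EuclideanSpace ℝ (Fin 3)) → Fin N → ℝ → EuclideanSpace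 ℝ (Fin 3)), (∀ Z y, u Z y = ∑ k, (Γ*γ k/(4*Real.pi))•∫ σ:ℝ, ((‖y-Z k σ‖^2+Real.exp (-(1+Real.eulerMascheroniConstant-Real.log 2))*Aa k σ)^(3/2:ℝ))⁻¹•cross (deriv (Z k) σ) (y-Z k σ))→(∀ y, v y = u X y+(1/2:ℝ)•y-α•cross (EuclideanSpace.single 2 1) y)→(∀ j, A j = fderiv ℝ v (X j (c j)))→(∀ Z j τ, T Z j τ = (u Z (Z j τ)+(1/2:ℝ)•Z j τ-α•cross (EuclideanSpace.single 2 1) (Z j τ))-(⟪u Z (Z j τ)+(1/2:ℝ)•Z j τ-α•cross (EuclideanSpace.single 2 1) (Z j τ), deriv (Z j) τ⟫_ℝ/‖deriv (Z j) τ‖^2)•deriv (Z j) τ)→(α ≠ 0 ∧ (∀ j, γ j ≠ 0) ∧ (∀ j, ContDiff ℝ 2 (X j) ∧ Differentiable ℝ (w j)∧(∀ τ, ‖deriv (X j) τ‖ = 1)∧(∀ τ, ‖iteratedDeriv 2 (X j) τ‖*√Γ≤K) ∧ Tendsto (fun τ => ‖X j τ‖) (cocompact ℝ) atTop) ∧ (∀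 j k, j ≠ k → ∀ τ σ, ρ*√Γ≤‖X j τ-X k σ‖) ∧ (∀ j τ σ, ρ*√Γ≤|τ-σ| → cg*ρ*√Γ≤‖X j τ-X j σ‖) ∧ (∀ j τ, cg*|τ-c j|≤Rw*√Γ+‖X j τ‖) ∧ (∀ j τ, w j τ = ⟪v (X j τ), deriv (X j) τ⟫_ℝ) ∧ (∀ j τ, ‖X j τ‖≤Rb*√(Γ*Real.log Γ) → v (X j τ) = w j τ•deriv (X j) τ) ∧ (∀ j, ‖X j (c j)‖≤Rw*√Γ) ∧ (∀ j, |⟪deriv (X j) (c j), EuclideanSpace.single 2 1⟫_ℝ|≤1-θ₀) ∧ (θ₀≤|α| ∧ |α|≤θ₀⁻¹ ∧ ∀ j, θ₀≤|γ j| ∧ |γ j|≤θ₀⁻¹) ∧ (∀ j, w j (c j) = 0 ∧ (∀ τ, w j τ = 0 → τ = c j) ∧ 3/2+δ≤deriv (w j) (c j) ∧ deriv (w j) (c j)≤Λ) ∧ (∀ j, Differentiable ℝ (Aa j) ∧ (∀ τ, 0 < Aa j τ) ∧ 1≤KA*Aa j (c j) ∧ ∀ τ, ‖X j τ‖≤2*Rb*√(Γ*Real.log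 Γ) → Aa j τ = Aa j (c j)) ∧ (∀ j τ, Rw^2*Γ*Aa j τ≤KA*(Rw^2*Γ+‖X j τ‖^2)))) → ((∀ j τ σ, ‖deriv (X j) τ - deriv (X j) σ‖ ≤ Rb) ∧ (∀ j τ, |deriv (w j) τ| ≤ Λ) ∧ (∀ j τ, Λ⁻¹ ≤ Aa j τ)) → (∀ (u:(Fin N → ℝ → EuclideanSpace ℝ (Fin 3)) → EuclideanSpace ℝ (Fin 3) → EuclideanSpace ℝ (Fin 3)) (v:EuclideanSpace ℝ (Fin 3) → EuclideanSpace ℝ (Fin 3)) (A:Fin N → (EuclideanSpace ℝ (Fin 3) →L[ℝ] EuclideanSpace ℝ (Fin 3))) (T:(Fin N → ℝ → EuclideanSpace ℝ (Fin 3)) → Fin N → ℝ → EuclideanSpace ℝ (Fin 3)), (∀ Z y, u Z y = ∑ k, (Γ*γ k/(4*Real.pi))•∫ σ:ℝ, ((‖y-Z k σ‖^2+Real.exp (-(1+Real.eulerMascheroniConstant-Real.log 2))*Aa k σ)^(3/2:ℝ))⁻¹•cross (deriv (Z k) σ) (y-Z k σ))→(∀ y, v y = u X y+(1/2:ℝ)•y-α•cross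 (EuclideanSpace.single 2 1) y)→(∀ j, A j = fderiv ℝ v (X j (c j)))→(∀ Z j τ, T Z j τ = (u Z (Z j τ)+(1/2:ℝ)•Z j τ-α•cross (EuclideanSpace.single 2 1) (Z j τ))-(⟪u Z (Z j τ)+(1/2:ℝ)•Z j τ-α•cross (EuclideanSpace.single 2 1) (Z j τ), deriv (Z j) τ⟫_ℝ/‖deriv (Z j) τ‖^2)•deriv (Z j) τ)→(∀ Y:Fin N → ℝ → EuclideanSpace ℝ (Fin 3), (∀ j, ContDiff ℝ 2 (Y j))→(∀ j τ, ⟪Y j τ, deriv (X j) τ⟫_ℝ = 0) → (∀ j τ, Rb*√(Γ*Real.log Γ) < ‖X j τ‖ → Y j τ = 0) → ∑ j, ⟪Y j (c j), cross (EuclideanSpace.single 2 1) (X j (c j))⟫_ℝ = 0 → (∀ j τ, ‖Y j τ‖+‖deriv (Y j) τ‖+‖iteratedDeriv 2 (Y j) τ‖≤(1+|τ-c j|)^b) → ∀ dα L S:ℝ, (∀ j τ, ‖Y j τ‖≤S*(1+|τ-c j|)^b) → (∀ j τ, ‖X j τ‖≤Rb*√(Γ*Real.log Γ) → ‖deriv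 (fun s:ℝ => T (fun k σ => X k σ+s•Y k σ) j τ) 0-dα•(cross (EuclideanSpace.single 2 1) (X j τ)-⟪cross (EuclideanSpace.single 2 1) (X j τ), deriv (X j) τ⟫_ℝ•deriv (X j) τ)‖≤L) → |dα| * √Γ≤cnd*L+ε*S))) := by
  intro N δ ρ K Λ Rw cg θ₀ KA hN hδ hρ hRw hcg hθ₀
  obtain ⟨Rb₀, hRb₀, hfam⟩ := hR N δ ρ K Λ Rw cg θ₀ KA hN hδ hρ hRw hcg hθ₀
  refine ⟨Rb₀, hRb₀, fun Rb hRb hRble b ε hε => ?_⟩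
  obtain ⟨cnd, Γ₀, hcnd, hΓ⟩ := hfam Rb hRb hRble b
  refine ⟨cnd, Γ₀, hcnd, fun Γ hΓle => ?_⟩
  intro γ α X w c Aa hH hNS u v A T hu hv hA hT Y hY2 hYn hYoff hYph hYenv dα L S hS hdef
  have hrate := hΓ Γ hΓle γ α X w c Aa hH hNS u v A T hu hv hA hT Y hY2 hYn hYoff hYph hYenv dα L hdef
  have hS0 : 0 ≤ S := by
    have h := hS ⟨0, hN⟩ (c ⟨0, hN⟩)
    rw [sub_self, abs_zero, add_zero, Real.one_rpow, mul_one] at h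
    exact le_trans (norm_nonneg _) h
  linarith [mul_nonneg hε.le hS0]

end Summit.NavierStokesRegularity.NavierStokesRegularity.Theorems.Clause13RLeakySplit

end
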